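import Summits.SmoothPoincare4.SmoothPoincare4.Theorems.CongruenceShadowsShadowApproximationStubLayerStepZeroTwoCalculus
import HarnessLib

/-!
# Helper VI (the bounding-pair map and its conjugates: degree-one data) for stub `stub_layerStepZeroTwo` of line
`nilpotent-genus-class`, crux `CongruenceShadows.ShadowApproximation` (item stmt-SmoothPoincare4-14595)

Genus `3`, notation of the siblings (`Nᵢ = s4Kernels i`, `γₖ₊₁ = (⊤).lowerCentralSeries k`, `𝒥ₖ`, the symbols `θₖ`
of `F₃` and the erasing projection `π` of `N₂` as hypotheses on variables).
* `exists_bp_goeritz` — the genus-one BOUNDING-PAIR MAP `β` on handles `0, 1` (landed `exists_bp`) is a Goeritz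
  element (`β(N₀) = N₀`, `β(N₁) = N₁`), is IA, and its Johnson values at the letters are
  `β(a₀)a₀⁻¹ ≡ ⁅b₁⁻¹, a₀⁆`, `β(b₀)b₀⁻¹ ≡ ⁅b₁⁻¹, b₀⁆`, `β(a₁)a₁⁻¹ ≡ ⁅a₀, b₀⁆⁻¹`, `β(b₁)b₁⁻¹ ≡ 1 (mod γ₃)`,
  `β(a₂) = a₂`, `β(b₂) = b₂`;
* `bpconj_class` — for `g ∈ Aut S₃` inducing `F` on `H₁`, the value of the conjugate `x = g β g⁻¹ ∈ 𝒥₁` at ANY `t`: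
  `x(t)t⁻¹ ≡ ⁅(g b₁)⁻¹, g a₀⁆^{n_{a₀}} ⁅(g b₁)⁻¹, g b₀⁆^{n_{b₀}} ⁅g a₀, g b₀⁆^{-n_{a₁}} (mod γ₃)`, `n = F⁻¹[t]`
  (IA-calculus modulo `γ₃`), and `bpconj_datum` — its symbol `θ₁(π(x(t)t⁻¹)) ∈ L₂`.
No definitions, no notations.
-/

set_option linter.dupNamespace false

noncomputable section

open Subgroup Literature.Topology.FourManifolds Literature.Algebra.Lie Multiplicative
open Summit.SmoothPoincare4.SmoothPoincare4.Theorems.NilpotentShadowsStandard.SaturatedTorsorDescent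
open Literature.Topology.FourManifolds.RelatorAut (s4Kernels_zero s4Kernels_one map_normalClosure_eq_of)
open scoped commutatorElement

namespace Summit.SmoothPoincare4.SmoothPoincare4.Theorems.ShadowApproximation.NilpotentGenusClass

namespace LayerZeroTwo

open LayerZeroOne

/-! ## The bounding-pair map `β` -/

/-- **The bounding-pair map as a Goeritz element of `𝒥₁` with its letter values modulo `γ₃`.** [folklore] -/
theorem exists_bp_goeritz : ∃ β : SurfaceGroup 3 ≃* SurfaceGroup 3,
    (s4Kernels 0).map β.toMonoidHom = s4Kernels 0 ∧ (s4Kernels 1).map β.toMonoidHom = s4Kernels 1 ∧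
    (∀ s, β s * s⁻¹ ∈ (⊤ : Subgroup (SurfaceGroup 3)).lowerCentralSeries 1) ∧
    (((β (PresentedGroup.of ((0 : Fin 3), false)) * (PresentedGroup.of ((0 : Fin 3), false) : SurfaceGroup 3)⁻¹ : SurfaceGroup 3)) :
        SurfaceGroup 3 ⧸ (⊤ : Subgroup (SurfaceGroup 3)).lowerCentralSeries 2) =
      ⁅((PresentedGroup.of ((1 : Fin 3), true) : SurfaceGroup 3) : SurfaceGroup 3 ⧸ (⊤ : Subgroup (SurfaceGroup 3)).lowerCentralSeries 2)⁻¹,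
        ((PresentedGroup.of ((0 : Fin 3), false) : SurfaceGroup 3) : SurfaceGroup 3 ⧸ (⊤ : Subgroup (SurfaceGroup 3)).lowerCentralSeries 2)⁆ ∧
    (((β (PresentedGroup.of ((0 : Fin 3), true)) * (PresentedGroup.of ((0 : Fin 3), true) : SurfaceGroup 3)⁻¹ : SurfaceGroup 3)) :
        SurfaceGroup 3 ⧸ (⊤ : Subgroup (SurfaceGroup 3)).lowerCentralSeries 2) =
      ⁅((PresentedGroup.of ((1 : Fin 3), true) : SurfaceGroup 3) : SurfaceGroup 3 ⧸ (⊤ : Subgroup (SurfaceGroup 3)).lowerCentralSeries 2)⁻¹,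
        ((PresentedGroup.of ((0 : Fin 3), true) : SurfaceGroup 3) : SurfaceGroup 3 ⧸ (⊤ : Subgroup (SurfaceGroup 3)).lowerCentralSeries 2)⁆ ∧
    (((β (PresentedGroup.of ((1 : Fin 3), false)) * (PresentedGroup.of ((1 : Fin 3), false) : SurfaceGroup 3)⁻¹ : SurfaceGroup 3)) :
        SurfaceGroup 3 ⧸ (⊤ : Subgroup (SurfaceGroup 3)).lowerCentralSeries 2) =
      (⁅((PresentedGroup.of ((0 : Fin 3), false) : SurfaceGroup 3) : SurfaceGroup 3 ⧸ (⊤ : Subgroup (SurfaceGroup 3)).lowerCentralSeries 2),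
        ((PresentedGroup.of ((0 : Fin 3), true) : SurfaceGroup 3) : SurfaceGroup 3 ⧸ (⊤ : Subgroup (SurfaceGroup 3)).lowerCentralSeries 2)⁆)⁻¹ ∧
    (((β (PresentedGroup.of ((1 : Fin 3), true)) * (PresentedGroup.of ((1 : Fin 3), true) : SurfaceGroup 3)⁻¹ : SurfaceGroup 3)) :
        SurfaceGroup 3 ⧸ (⊤ : Subgroup (SurfaceGroup 3)).lowerCentralSeries 2) = 1 ∧
    β (PresentedGroup.of ((2 : Fin 3), false)) = PresentedGroup.of ((2 : Fin 3), false) ∧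
    β (PresentedGroup.of ((2 : Fin 3), true)) = PresentedGroup.of ((2 : Fin 3), true) := by
  obtain ⟨β, ⟨ha0, hb0, ha1, hb1, ha2, hb2⟩, ⟨ha0', hb0', ha1', hb1', ha2', hb2'⟩⟩ := exists_bp
  haveI hn0 : (s4Kernels 0).Normal := s4Kernels_isGroupTrisection_holds.normal 0
  haveI hn1 : (s4Kernels 1).Normal := s4Kernels_isGroupTrisection_holds.normal 1
  -- letters and `c₀ = [a₀, b₀] = a₀ · (b₀ a₀⁻¹ b₀⁻¹)` in `N₀`, `N₁`
  have a0N0 : ((SurfaceGroup.a 0 : SurfaceGroup 3)) ∈ (s4Kernels 0) := subset_normalClosure (by simp)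
  have a1N0 : ((SurfaceGroup.a 1 : SurfaceGroup 3)) ∈ (s4Kernels 0) := subset_normalClosure (by simp)
  have b2N0 : ((SurfaceGroup.b 2 : SurfaceGroup 3)) ∈ (s4Kernels 0) := subset_normalClosure (by simp)
  have a0N1 : ((SurfaceGroup.a 0 : SurfaceGroup 3)) ∈ (s4Kernels 1) := subset_normalClosure (by simp)
  have b1N1 : ((SurfaceGroup.b 1 : SurfaceGroup 3)) ∈ (s4Kernels 1) := subset_normalClosure (by simp)
  have a2N1 : ((SurfaceGroup.a 2 : SurfaceGroup 3)) ∈ (s4Kernels 1) := subset_normalClosure (by simp)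
  have hC0 : ⁅(SurfaceGroup.a 0 : SurfaceGroup 3), (SurfaceGroup.b 0 : SurfaceGroup 3)⁆ ∈ (s4Kernels 0) := by
    rw [commutatorElement_def, mul_assoc, mul_assoc]
    exact mul_mem a0N0 (by simpa [mul_assoc] using hn0.conj_mem _ (inv_mem a0N0) ((SurfaceGroup.b 0 : SurfaceGroup 3)))
  have hC1 : ⁅(SurfaceGroup.a 0 : SurfaceGroup 3), (SurfaceGroup.b 0 : SurfaceGroup 3)⁆ ∈ (s4Kernels 1) := by
    rw [commutatorElement_def, mul_assoc, mul_assoc]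
    exact mul_mem a0N1 (by simpa [mul_assoc] using hn1.conj_mem _ (inv_mem a0N1) ((SurfaceGroup.b 0 : SurfaceGroup 3)))
  have cj0 : ∀ (h x : (SurfaceGroup 3)), x ∈ (s4Kernels 0) → h * x * h⁻¹ ∈ (s4Kernels 0) := fun h x hx =>
    (inferInstance : (s4Kernels 0).Normal).conj_mem x hx h
  have cj0' : ∀ (h x : (SurfaceGroup 3)), x ∈ (s4Kernels 0) → h⁻¹ * x * h ∈ (s4Kernels 0) := fun h x hx => by
    simpa using (inferInstance : (s4Kernels 0).Normal).conj_mem x hx h⁻¹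
  -- `β` stabilises `N₀` and `N₁`
  have hβ0 : (s4Kernels 0).map β.toMonoidHom = (s4Kernels 0) := by
    rw [s4Kernels_zero]
    refine map_normalClosure_eq_of _ _ _ ?_ ?_
    · rintro x (rfl | rfl | rfl)
      · rw [ha0, ← s4Kernels_zero]
        have e : ⁅(SurfaceGroup.a 0 : SurfaceGroup 3), (SurfaceGroup.b 0 : SurfaceGroup 3)⁆ * ((SurfaceGroup.b 1 : SurfaceGroup 3))⁻¹ * ((SurfaceGroup.a 0 : SurfaceGroup 3)) * ((SurfaceGroup.b 1 : SurfaceGroup 3)) * ⁅(SurfaceGroup.a 0 : SurfaceGroup 3), (SurfaceGroup.b 0 : SurfaceGroup 3)⁆⁻¹ =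
            ⁅(SurfaceGroup.a 0 : SurfaceGroup 3), (SurfaceGroup.b 0 : SurfaceGroup 3)⁆ * (((SurfaceGroup.b 1 : SurfaceGroup 3))⁻¹ * ((SurfaceGroup.a 0 : SurfaceGroup 3)) * ((SurfaceGroup.b 1 : SurfaceGroup 3))) * ⁅(SurfaceGroup.a 0 : SurfaceGroup 3), (SurfaceGroup.b 0 : SurfaceGroup 3)⁆⁻¹ := by group
        rw [e]; exact cj0 _ _ (cj0' _ _ a0N0)
      · rw [ha1, ← s4Kernels_zero]
        have e : ⁅(SurfaceGroup.a 0 : SurfaceGroup 3), (SurfaceGroup.b 0 : SurfaceGroup 3)⁆ * ((SurfaceGroup.b 1 : SurfaceGroup 3))⁻¹ * ⁅(SurfaceGroup.a 0 : SurfaceGroup 3), (SurfaceGroup.b 0 : SurfaceGroup 3)⁆⁻¹ * ((SurfaceGroup.b 1 : SurfaceGroup 3)) * ((SurfaceGroup.a 1 : SurfaceGroup 3)) * ⁅(SurfaceGroup.a 0 : SurfaceGroup 3), (SurfaceGroup.b 0 : SurfaceGroup 3)⁆⁻¹ =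
            ⁅(SurfaceGroup.a 0 : SurfaceGroup 3), (SurfaceGroup.b 0 : SurfaceGroup 3)⁆ * ((((SurfaceGroup.b 1 : SurfaceGroup 3))⁻¹ * ⁅(SurfaceGroup.a 0 : SurfaceGroup 3), (SurfaceGroup.b 0 : SurfaceGroup 3)⁆⁻¹ * ((SurfaceGroup.b 1 : SurfaceGroup 3))) * ((SurfaceGroup.a 1 : SurfaceGroup 3))) * ⁅(SurfaceGroup.a 0 : SurfaceGroup 3), (SurfaceGroup.b 0 : SurfaceGroup 3)⁆⁻¹ := by group
        rw [e]; exact cj0 _ _ (mul_mem (cj0' _ _ (inv_mem hC0)) a1N0)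
      · rw [hb2, ← s4Kernels_zero]; exact b2N0
    · rintro x (rfl | rfl | rfl)
      · rw [ha0', ← s4Kernels_zero]
        have e : ((SurfaceGroup.b 1 : SurfaceGroup 3)) * ⁅(SurfaceGroup.a 0 : SurfaceGroup 3), (SurfaceGroup.b 0 : SurfaceGroup 3)⁆⁻¹ * ((SurfaceGroup.a 0 : SurfaceGroup 3)) * ⁅(SurfaceGroup.a 0 : SurfaceGroup 3), (SurfaceGroup.b 0 : SurfaceGroup 3)⁆ * ((SurfaceGroup.b 1 : SurfaceGroup 3))⁻¹ =
            ((SurfaceGroup.b 1 : SurfaceGroup 3)) * (⁅(SurfaceGroup.a 0 : SurfaceGroup 3), (SurfaceGroup.b 0 : SurfaceGroup 3)⁆⁻¹ * ((SurfaceGroup.a 0 : SurfaceGroup 3)) * ⁅(SurfaceGroup.a 0 : SurfaceGroup 3), (SurfaceGroup.b 0 : SurfaceGroup 3)⁆) * ((SurfaceGroup.b 1 : SurfaceGroup 3))⁻¹ := by group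
        rw [e]; exact cj0 _ _ (cj0' _ _ a0N0)
      · rw [ha1', ← s4Kernels_zero]
        have e : ((SurfaceGroup.b 1 : SurfaceGroup 3)) * ⁅(SurfaceGroup.a 0 : SurfaceGroup 3), (SurfaceGroup.b 0 : SurfaceGroup 3)⁆⁻¹ * ((SurfaceGroup.b 1 : SurfaceGroup 3))⁻¹ * ⁅(SurfaceGroup.a 0 : SurfaceGroup 3), (SurfaceGroup.b 0 : SurfaceGroup 3)⁆ * ((SurfaceGroup.a 1 : SurfaceGroup 3)) * ((SurfaceGroup.b 1 : SurfaceGroup 3)) * ⁅(SurfaceGroup.a 0 : SurfaceGroup 3), (SurfaceGroup.b 0 : SurfaceGroup 3)⁆ * ((SurfaceGroup.b 1 : SurfaceGroup 3))⁻¹ =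
            (((SurfaceGroup.b 1 : SurfaceGroup 3)) * ⁅(SurfaceGroup.a 0 : SurfaceGroup 3), (SurfaceGroup.b 0 : SurfaceGroup 3)⁆⁻¹ * ((SurfaceGroup.b 1 : SurfaceGroup 3))⁻¹) * ⁅(SurfaceGroup.a 0 : SurfaceGroup 3), (SurfaceGroup.b 0 : SurfaceGroup 3)⁆ * ((SurfaceGroup.a 1 : SurfaceGroup 3)) * (((SurfaceGroup.b 1 : SurfaceGroup 3)) * ⁅(SurfaceGroup.a 0 : SurfaceGroup 3), (SurfaceGroup.b 0 : SurfaceGroup 3)⁆ * ((SurfaceGroup.b 1 : SurfaceGroup 3))⁻¹) := by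
          group
        rw [e]
        exact mul_mem (mul_mem (mul_mem (cj0 _ _ (inv_mem hC0)) hC0) a1N0) (cj0 _ _ hC0)
      · rw [hb2', ← s4Kernels_zero]; exact b2N0
  have hβ1 : (s4Kernels 1).map β.toMonoidHom = (s4Kernels 1) := by
    rw [s4Kernels_one]
    refine map_normalClosure_eq_of _ _ _ ?_ ?_
    · rintro x (rfl | rfl | rfl)
      · rw [ha0, ← s4Kernels_one]
        exact mul_mem (mul_mem (mul_mem (mul_mem hC1 (inv_mem b1N1)) a0N1) b1N1) (inv_mem hC1)
      · rw [hb1, ← s4Kernels_one]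
        exact mul_mem (mul_mem hC1 b1N1) (inv_mem hC1)
      · rw [ha2, ← s4Kernels_one]; exact a2N1
    · rintro x (rfl | rfl | rfl)
      · rw [ha0', ← s4Kernels_one]
        exact mul_mem (mul_mem (mul_mem (mul_mem b1N1 (inv_mem hC1)) a0N1) hC1) (inv_mem b1N1)
      · rw [hb1', ← s4Kernels_one]
        exact mul_mem (mul_mem (mul_mem (mul_mem b1N1 (inv_mem hC1)) b1N1) hC1) (inv_mem b1N1)
      · rw [ha2', ← s4Kernels_one]; exact a2N1
  -- `β` is IA
  have hβIA : ∀ s, β s * s⁻¹ ∈ ((⊤ : Subgroup (SurfaceGroup 3)).lowerCentralSeries 1) := by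
    have hhom : (SurfaceGroup.abelianize 3).comp β.toMonoidHom = SurfaceGroup.abelianize 3 := by
      refine PresentedGroup.ext fun x => ?_
      rw [MonoidHom.comp_apply, MulEquiv.coe_toMonoidHom]
      apply toAdd.injective
      obtain ⟨j, c⟩ := x
      fin_cases j <;> cases c
      · change toAdd (SurfaceGroup.abelianize 3 (β ((SurfaceGroup.a 0 : SurfaceGroup 3)))) = toAdd (SurfaceGroup.abelianize 3 ((SurfaceGroup.a 0 : SurfaceGroup 3)))
        rw [ha0]; simp only [map_mul, map_inv, toAdd_mul, toAdd_inv,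
          commutatorElement_def]; abel
      · change toAdd (SurfaceGroup.abelianize 3 (β ((SurfaceGroup.b 0 : SurfaceGroup 3)))) = toAdd (SurfaceGroup.abelianize 3 ((SurfaceGroup.b 0 : SurfaceGroup 3)))
        rw [hb0]; simp only [map_mul, map_inv, toAdd_mul, toAdd_inv,
          commutatorElement_def]; abel
      · change toAdd (SurfaceGroup.abelianize 3 (β ((SurfaceGroup.a 1 : SurfaceGroup 3)))) = toAdd (SurfaceGroup.abelianize 3 ((SurfaceGroup.a 1 : SurfaceGroup 3)))
        rw [ha1]; simp only [map_mul, map_inv, toAdd_mul, toAdd_inv,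
          commutatorElement_def]; abel
      · change toAdd (SurfaceGroup.abelianize 3 (β ((SurfaceGroup.b 1 : SurfaceGroup 3)))) = toAdd (SurfaceGroup.abelianize 3 ((SurfaceGroup.b 1 : SurfaceGroup 3)))
        rw [hb1]; simp only [map_mul, map_inv, toAdd_mul, toAdd_inv,
          commutatorElement_def]; abel
      · change toAdd (SurfaceGroup.abelianize 3 (β ((SurfaceGroup.a 2 : SurfaceGroup 3)))) = toAdd (SurfaceGroup.abelianize 3 ((SurfaceGroup.a 2 : SurfaceGroup 3)))
        rw [ha2]
      · change toAdd (SurfaceGroup.abelianize 3 (β ((SurfaceGroup.b 2 : SurfaceGroup 3)))) = toAdd (SurfaceGroup.abelianize 3 ((SurfaceGroup.b 2 : SurfaceGroup 3)))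
        rw [hb2]
    intro s
    have hs := DFunLike.congr_fun hhom s
    rw [MonoidHom.comp_apply, MulEquiv.coe_toMonoidHom] at hs
    exact mul_inv_mem_γ₂ (congrArg toAdd hs)
  -- letter values modulo `γ₃`
  have hC : ∀ z : SurfaceGroup 3 ⧸ (⊤ : Subgroup (SurfaceGroup 3)).lowerCentralSeries 2,
      ⁅((⁅(PresentedGroup.of ((0 : Fin 3), false) : SurfaceGroup 3), (PresentedGroup.of ((0 : Fin 3), true) : SurfaceGroup 3)⁆ : SurfaceGroup 3) :
        SurfaceGroup 3 ⧸ (⊤ : Subgroup (SurfaceGroup 3)).lowerCentralSeries 2), z⁆ = 1 := fun z => by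
    rw [quot_commutatorElement]; exact quot_class_two _ _ _
  have hC' : ∀ z : SurfaceGroup 3 ⧸ (⊤ : Subgroup (SurfaceGroup 3)).lowerCentralSeries 2,
      ⁅z, ((⁅(PresentedGroup.of ((0 : Fin 3), false) : SurfaceGroup 3), (PresentedGroup.of ((0 : Fin 3), true) : SurfaceGroup 3)⁆ : SurfaceGroup 3) :
        SurfaceGroup 3 ⧸ (⊤ : Subgroup (SurfaceGroup 3)).lowerCentralSeries 2)⁻¹⁆ = 1 := fun z => by
    rw [c2_inv_right quot_class_two, inv_eq_one, ← commutatorElement_inv, inv_eq_one, quot_commutatorElement]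
    exact quot_class_two _ _ _
  refine ⟨β, hβ0, hβ1, hβIA, ?_, ?_, ?_, ?_, ha2, hb2⟩
  · have e : β ((PresentedGroup.of ((0 : Fin 3), false) : SurfaceGroup 3)) * (PresentedGroup.of ((0 : Fin 3), false) : SurfaceGroup 3)⁻¹ =
        ⁅⁅(PresentedGroup.of ((0 : Fin 3), false) : SurfaceGroup 3), (PresentedGroup.of ((0 : Fin 3), true) : SurfaceGroup 3)⁆,
          ((PresentedGroup.of ((1 : Fin 3), true) : SurfaceGroup 3))⁻¹ * (PresentedGroup.of ((0 : Fin 3), false) : SurfaceGroup 3) * (PresentedGroup.of ((1 : Fin 3), true) : SurfaceGroup 3)⁆ *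
        ⁅(PresentedGroup.of ((1 : Fin 3), true) : SurfaceGroup 3)⁻¹, (PresentedGroup.of ((0 : Fin 3), false) : SurfaceGroup 3)⁆ := by
      rw [show (PresentedGroup.of ((0 : Fin 3), false) : SurfaceGroup 3) = SurfaceGroup.a 0 from rfl, ha0]; simp only [SurfaceGroup.a, SurfaceGroup.b, commutatorElement_def]; group
    rw [e, QuotientGroup.mk_mul, quot_commutatorElement, hC, one_mul, quot_commutatorElement, QuotientGroup.mk_inv]
  · have e : β ((PresentedGroup.of ((0 : Fin 3), true) : SurfaceGroup 3)) * (PresentedGroup.of ((0 : Fin 3), true) : SurfaceGroup 3)⁻¹ =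
        ⁅⁅(PresentedGroup.of ((0 : Fin 3), false) : SurfaceGroup 3), (PresentedGroup.of ((0 : Fin 3), true) : SurfaceGroup 3)⁆,
          ((PresentedGroup.of ((1 : Fin 3), true) : SurfaceGroup 3))⁻¹ * (PresentedGroup.of ((0 : Fin 3), true) : SurfaceGroup 3) * (PresentedGroup.of ((1 : Fin 3), true) : SurfaceGroup 3)⁆ *
        ⁅(PresentedGroup.of ((1 : Fin 3), true) : SurfaceGroup 3)⁻¹, (PresentedGroup.of ((0 : Fin 3), true) : SurfaceGroup 3)⁆ := by
      rw [show (PresentedGroup.of ((0 : Fin 3), true) : SurfaceGroup 3) = SurfaceGroup.b 0 from rfl, hb0]; simp only [SurfaceGroup.a, SurfaceGroup.b, commutatorElement_def]; group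
    rw [e, QuotientGroup.mk_mul, quot_commutatorElement, hC, one_mul, quot_commutatorElement, QuotientGroup.mk_inv]
  · have e : β ((PresentedGroup.of ((1 : Fin 3), false) : SurfaceGroup 3)) * (PresentedGroup.of ((1 : Fin 3), false) : SurfaceGroup 3)⁻¹ =
        ⁅⁅(PresentedGroup.of ((0 : Fin 3), false) : SurfaceGroup 3), (PresentedGroup.of ((0 : Fin 3), true) : SurfaceGroup 3)⁆, ((PresentedGroup.of ((1 : Fin 3), true) : SurfaceGroup 3))⁻¹⁆ *
        ⁅(PresentedGroup.of ((1 : Fin 3), false) : SurfaceGroup 3), (⁅(PresentedGroup.of ((0 : Fin 3), false) : SurfaceGroup 3), (PresentedGroup.of ((0 : Fin 3), true) : SurfaceGroup 3)⁆)⁻¹⁆ *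
        (⁅(PresentedGroup.of ((0 : Fin 3), false) : SurfaceGroup 3), (PresentedGroup.of ((0 : Fin 3), true) : SurfaceGroup 3)⁆)⁻¹ := by
      rw [show (PresentedGroup.of ((1 : Fin 3), false) : SurfaceGroup 3) = SurfaceGroup.a 1 from rfl, ha1]; simp only [SurfaceGroup.a, SurfaceGroup.b, commutatorElement_def]; group
    rw [e, QuotientGroup.mk_mul, QuotientGroup.mk_mul, quot_commutatorElement, hC, one_mul, quot_commutatorElement,
      QuotientGroup.mk_inv, hC', one_mul, quot_commutatorElement]
  · have e : β ((PresentedGroup.of ((1 : Fin 3), true) : SurfaceGroup 3)) * (PresentedGroup.of ((1 : Fin 3), true) : SurfaceGroup 3)⁻¹ =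
        ⁅⁅(PresentedGroup.of ((0 : Fin 3), false) : SurfaceGroup 3), (PresentedGroup.of ((0 : Fin 3), true) : SurfaceGroup 3)⁆, ((PresentedGroup.of ((1 : Fin 3), true) : SurfaceGroup 3))⁆ := by
      rw [show (PresentedGroup.of ((1 : Fin 3), true) : SurfaceGroup 3) = SurfaceGroup.b 1 from rfl, hb1]; rfl
    rw [e, quot_commutatorElement, hC]


/-! ## Conjugates `x = g β g⁻¹` of the bounding-pair map: values modulo `γ₃` and degree-one data -/

section Symbols

variable (θ : ℕ → FreeGroup (Fin 3) → FreeLieAlgebra ℤ (Fin 3))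
  (hadd : ∀ k, ∀ x ∈ (⊤ : Subgroup (FreeGroup (Fin 3))).lowerCentralSeries k,
    ∀ y ∈ (⊤ : Subgroup (FreeGroup (Fin 3))).lowerCentralSeries k, θ k (x * y) = θ k x + θ k y)
  (hker : ∀ k, ∀ x ∈ (⊤ : Subgroup (FreeGroup (Fin 3))).lowerCentralSeries k,
    θ k x = 0 ↔ x ∈ (⊤ : Subgroup (FreeGroup (Fin 3))).lowerCentralSeries (k + 1))
  (hbr : ∀ j k, ∀ x ∈ (⊤ : Subgroup (FreeGroup (Fin 3))).lowerCentralSeries j,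
    ∀ y ∈ (⊤ : Subgroup (FreeGroup (Fin 3))).lowerCentralSeries k, θ (j + k + 1) ⁅x, y⁆ = ⁅θ j x, θ k y⁆)
  (π : SurfaceGroup 3 →* FreeGroup (Fin 3))

/-- **The value of a conjugate of the bounding-pair map at an arbitrary argument, modulo `γ₃`.** For `β` IA with the
letter values of `exists_bp_goeritz` and `g ∈ Aut S₃` inducing `F` on `H₁`, the conjugate `x = g β g⁻¹` has
`x(t)t⁻¹ ≡ ⁅(g b₁)⁻¹, g a₀⁆^{n_{a₀}} ⁅(g b₁)⁻¹, g b₀⁆^{n_{b₀}} ⁅g a₀, g b₀⁆^{-n_{a₁}} (mod γ₃)`, `n = F⁻¹[t]`. [folklore] -/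
theorem bpconj_class (β g : SurfaceGroup 3 ≃* SurfaceGroup 3) (F : (surfaceGen 3 → ℤ) ≃ₗ[ℤ] (surfaceGen 3 → ℤ))
    (hβIA : ∀ s, β s * s⁻¹ ∈ (⊤ : Subgroup (SurfaceGroup 3)).lowerCentralSeries 1)
    (hβa0 : (((β (PresentedGroup.of ((0 : Fin 3), false)) * (PresentedGroup.of ((0 : Fin 3), false) : SurfaceGroup 3)⁻¹ : SurfaceGroup 3)) :
        SurfaceGroup 3 ⧸ (⊤ : Subgroup (SurfaceGroup 3)).lowerCentralSeries 2) =
      ⁅((PresentedGroup.of ((1 : Fin 3), true) : SurfaceGroup 3) : SurfaceGroup 3 ⧸ (⊤ : Subgroup (SurfaceGroup 3)).lowerCentralSeries 2)⁻¹,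
        ((PresentedGroup.of ((0 : Fin 3), false) : SurfaceGroup 3) : SurfaceGroup 3 ⧸ (⊤ : Subgroup (SurfaceGroup 3)).lowerCentralSeries 2)⁆)
    (hβb0 : (((β (PresentedGroup.of ((0 : Fin 3), true)) * (PresentedGroup.of ((0 : Fin 3), true) : SurfaceGroup 3)⁻¹ : SurfaceGroup 3)) :
        SurfaceGroup 3 ⧸ (⊤ : Subgroup (SurfaceGroup 3)).lowerCentralSeries 2) =
      ⁅((PresentedGroup.of ((1 : Fin 3), true) : SurfaceGroup 3) : SurfaceGroup 3 ⧸ (⊤ : Subgroup (SurfaceGroup 3)).lowerCentralSeries 2)⁻¹,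
        ((PresentedGroup.of ((0 : Fin 3), true) : SurfaceGroup 3) : SurfaceGroup 3 ⧸ (⊤ : Subgroup (SurfaceGroup 3)).lowerCentralSeries 2)⁆)
    (hβa1 : (((β (PresentedGroup.of ((1 : Fin 3), false)) * (PresentedGroup.of ((1 : Fin 3), false) : SurfaceGroup 3)⁻¹ : SurfaceGroup 3)) :
        SurfaceGroup 3 ⧸ (⊤ : Subgroup (SurfaceGroup 3)).lowerCentralSeries 2) =
      (⁅((PresentedGroup.of ((0 : Fin 3), false) : SurfaceGroup 3) : SurfaceGroup 3 ⧸ (⊤ : Subgroup (SurfaceGroup 3)).lowerCentralSeries 2),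
        ((PresentedGroup.of ((0 : Fin 3), true) : SurfaceGroup 3) : SurfaceGroup 3 ⧸ (⊤ : Subgroup (SurfaceGroup 3)).lowerCentralSeries 2)⁆)⁻¹)
    (hβb1 : (((β (PresentedGroup.of ((1 : Fin 3), true)) * (PresentedGroup.of ((1 : Fin 3), true) : SurfaceGroup 3)⁻¹ : SurfaceGroup 3)) :
        SurfaceGroup 3 ⧸ (⊤ : Subgroup (SurfaceGroup 3)).lowerCentralSeries 2) = 1)
    (hβa2 : β (PresentedGroup.of ((2 : Fin 3), false)) = PresentedGroup.of ((2 : Fin 3), false))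
    (hβb2 : β (PresentedGroup.of ((2 : Fin 3), true)) = PresentedGroup.of ((2 : Fin 3), true))
    (hg : ∀ s, toAdd (SurfaceGroup.abelianize 3 (g s)) = F (toAdd (SurfaceGroup.abelianize 3 s))) (t : SurfaceGroup 3) :
    ((((g.symm.trans (β.trans g)) t * t⁻¹ : SurfaceGroup 3)) : SurfaceGroup 3 ⧸ (⊤ : Subgroup (SurfaceGroup 3)).lowerCentralSeries 2) =
      ((⁅(g (PresentedGroup.of ((1 : Fin 3), true)))⁻¹, g (PresentedGroup.of ((0 : Fin 3), false))⁆ ^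
            (F.symm (toAdd (SurfaceGroup.abelianize 3 t))) ((0 : Fin 3), false) *
          ⁅(g (PresentedGroup.of ((1 : Fin 3), true)))⁻¹, g (PresentedGroup.of ((0 : Fin 3), true))⁆ ^
            (F.symm (toAdd (SurfaceGroup.abelianize 3 t))) ((0 : Fin 3), true) *
          ⁅g (PresentedGroup.of ((0 : Fin 3), false)), g (PresentedGroup.of ((0 : Fin 3), true))⁆ ^
            (-(F.symm (toAdd (SurfaceGroup.abelianize 3 t))) ((1 : Fin 3), false)) : SurfaceGroup 3) :
        SurfaceGroup 3 ⧸ (⊤ : Subgroup (SurfaceGroup 3)).lowerCentralSeries 2) := by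
  obtain ⟨n, hn⟩ : ∃ n : surfaceGen 3 → ℤ, n = F.symm (toAdd (SurfaceGroup.abelianize 3 t)) := ⟨_, rfl⟩
  rw [← hn, conj_tau]
  obtain ⟨t', ht'⟩ : ∃ t', t' = g.symm t := ⟨_, rfl⟩
  rw [← ht']
  have habt : toAdd (SurfaceGroup.abelianize 3 t') = n := by
    have h1 := hg t'
    rw [ht', MulEquiv.apply_symm_apply] at h1
    rw [hn, h1, ← ht', LinearEquiv.symm_apply_apply]
  -- a product of powers of the letters in the class of `t'`
  obtain ⟨t₀, ht₀⟩ : ∃ t₀ : SurfaceGroup 3, t₀ =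
      (PresentedGroup.of ((0 : Fin 3), false) : SurfaceGroup 3) ^ n ((0 : Fin 3), false) *
      (PresentedGroup.of ((0 : Fin 3), true) : SurfaceGroup 3) ^ n ((0 : Fin 3), true) *
      (PresentedGroup.of ((1 : Fin 3), false) : SurfaceGroup 3) ^ n ((1 : Fin 3), false) *
      (PresentedGroup.of ((1 : Fin 3), true) : SurfaceGroup 3) ^ n ((1 : Fin 3), true) *
      (PresentedGroup.of ((2 : Fin 3), false) : SurfaceGroup 3) ^ n ((2 : Fin 3), false) *
      (PresentedGroup.of ((2 : Fin 3), true) : SurfaceGroup 3) ^ n ((2 : Fin 3), true) := ⟨_, rfl⟩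
  have hab_t₀ : toAdd (SurfaceGroup.abelianize 3 t₀) = n := by
    rw [ht₀]
    simp only [map_mul, map_zpow, toAdd_mul, toAdd_zpow, SurfaceGroup.abelianize_of, toAdd_ofAdd]
    ext ⟨i, c⟩
    fin_cases i <;> cases c <;> simp
  have htt₀ : t' * t₀⁻¹ ∈ (⊤ : Subgroup (SurfaceGroup 3)).lowerCentralSeries 1 :=
    mul_inv_mem_γ₂ (habt.trans hab_t₀.symm)
  have h2 : β (PresentedGroup.of ((2 : Fin 3), false)) * (PresentedGroup.of ((2 : Fin 3), false) : SurfaceGroup 3)⁻¹ = 1 := by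
    rw [hβa2, mul_inv_cancel]
  have h2' : β (PresentedGroup.of ((2 : Fin 3), true)) * (PresentedGroup.of ((2 : Fin 3), true) : SurfaceGroup 3)⁻¹ = 1 := by
    rw [hβb2, mul_inv_cancel]
  have hval : (((β t' * t'⁻¹ : SurfaceGroup 3)) : SurfaceGroup 3 ⧸ (⊤ : Subgroup (SurfaceGroup 3)).lowerCentralSeries 2) =
      ((⁅(PresentedGroup.of ((1 : Fin 3), true) : SurfaceGroup 3)⁻¹, (PresentedGroup.of ((0 : Fin 3), false) : SurfaceGroup 3)⁆ ^ n ((0 : Fin 3), false) *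
          ⁅(PresentedGroup.of ((1 : Fin 3), true) : SurfaceGroup 3)⁻¹, (PresentedGroup.of ((0 : Fin 3), true) : SurfaceGroup 3)⁆ ^ n ((0 : Fin 3), true) *
          ⁅(PresentedGroup.of ((0 : Fin 3), false) : SurfaceGroup 3), (PresentedGroup.of ((0 : Fin 3), true) : SurfaceGroup 3)⁆ ^ (-n ((1 : Fin 3), false)) :
          SurfaceGroup 3) : SurfaceGroup 3 ⧸ _) := by
    rw [jk_quot_congr hβIA htt₀, ht₀, jk_quot_mul hβIA, jk_quot_mul hβIA, jk_quot_mul hβIA, jk_quot_mul hβIA, jk_quot_mul hβIA,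
      jk_quot_zpow hβIA, jk_quot_zpow hβIA, jk_quot_zpow hβIA, jk_quot_zpow hβIA, jk_quot_zpow hβIA, jk_quot_zpow hβIA,
      hβa0, hβb0, hβa1, hβb1, h2, h2', QuotientGroup.mk_one, one_zpow, one_zpow, one_zpow, mul_one, mul_one, mul_one,
      inv_zpow', QuotientGroup.mk_mul, QuotientGroup.mk_mul, QuotientGroup.mk_zpow, QuotientGroup.mk_zpow, QuotientGroup.mk_zpow,
      quot_commutatorElement, quot_commutatorElement, quot_commutatorElement, QuotientGroup.mk_inv]
  rw [← mul_inv_mem_iff_quot] at hval ⊢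
  have h3 := equiv_mem_lcs g hval
  simpa only [map_mul, map_inv, map_zpow, map_commutatorElement] using h3

include hadd hker hbr in
/-- **The degree-one datum of a conjugate of the bounding-pair map at an arbitrary argument**:
`θ₁(π(x(t)t⁻¹)) = n_{a₀} ⁅-q₁, p₀⁆ + n_{b₀} ⁅-q₁, q₀⁆ - n_{a₁} ⁅p₀, q₀⁆` with `p₀, q₀, q₁ = θ₀π(g a₀), θ₀π(g b₀), θ₀π(g b₁)`
and `n = F⁻¹[t]`. [folklore] -/
theorem bpconj_datum (β g : SurfaceGroup 3 ≃* SurfaceGroup 3) (F : (surfaceGen 3 → ℤ) ≃ₗ[ℤ] (surfaceGen 3 → ℤ))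
    (hβIA : ∀ s, β s * s⁻¹ ∈ (⊤ : Subgroup (SurfaceGroup 3)).lowerCentralSeries 1)
    (hβa0 : (((β (PresentedGroup.of ((0 : Fin 3), false)) * (PresentedGroup.of ((0 : Fin 3), false) : SurfaceGroup 3)⁻¹ : SurfaceGroup 3)) :
        SurfaceGroup 3 ⧸ (⊤ : Subgroup (SurfaceGroup 3)).lowerCentralSeries 2) =
      ⁅((PresentedGroup.of ((1 : Fin 3), true) : SurfaceGroup 3) : SurfaceGroup 3 ⧸ (⊤ : Subgroup (SurfaceGroup 3)).lowerCentralSeries 2)⁻¹,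
        ((PresentedGroup.of ((0 : Fin 3), false) : SurfaceGroup 3) : SurfaceGroup 3 ⧸ (⊤ : Subgroup (SurfaceGroup 3)).lowerCentralSeries 2)⁆)
    (hβb0 : (((β (PresentedGroup.of ((0 : Fin 3), true)) * (PresentedGroup.of ((0 : Fin 3), true) : SurfaceGroup 3)⁻¹ : SurfaceGroup 3)) :
        SurfaceGroup 3 ⧸ (⊤ : Subgroup (SurfaceGroup 3)).lowerCentralSeries 2) =
      ⁅((PresentedGroup.of ((1 : Fin 3), true) : SurfaceGroup 3) : SurfaceGroup 3 ⧸ (⊤ : Subgroup (SurfaceGroup 3)).lowerCentralSeries 2)⁻¹,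
        ((PresentedGroup.of ((0 : Fin 3), true) : SurfaceGroup 3) : SurfaceGroup 3 ⧸ (⊤ : Subgroup (SurfaceGroup 3)).lowerCentralSeries 2)⁆)
    (hβa1 : (((β (PresentedGroup.of ((1 : Fin 3), false)) * (PresentedGroup.of ((1 : Fin 3), false) : SurfaceGroup 3)⁻¹ : SurfaceGroup 3)) :
        SurfaceGroup 3 ⧸ (⊤ : Subgroup (SurfaceGroup 3)).lowerCentralSeries 2) =
      (⁅((PresentedGroup.of ((0 : Fin 3), false) : SurfaceGroup 3) : SurfaceGroup 3 ⧸ (⊤ : Subgroup (SurfaceGroup 3)).lowerCentralSeries 2),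
        ((PresentedGroup.of ((0 : Fin 3), true) : SurfaceGroup 3) : SurfaceGroup 3 ⧸ (⊤ : Subgroup (SurfaceGroup 3)).lowerCentralSeries 2)⁆)⁻¹)
    (hβb1 : (((β (PresentedGroup.of ((1 : Fin 3), true)) * (PresentedGroup.of ((1 : Fin 3), true) : SurfaceGroup 3)⁻¹ : SurfaceGroup 3)) :
        SurfaceGroup 3 ⧸ (⊤ : Subgroup (SurfaceGroup 3)).lowerCentralSeries 2) = 1)
    (hβa2 : β (PresentedGroup.of ((2 : Fin 3), false)) = PresentedGroup.of ((2 : Fin 3), false))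
    (hβb2 : β (PresentedGroup.of ((2 : Fin 3), true)) = PresentedGroup.of ((2 : Fin 3), true))
    (hg : ∀ s, toAdd (SurfaceGroup.abelianize 3 (g s)) = F (toAdd (SurfaceGroup.abelianize 3 s))) (t : SurfaceGroup 3) :
    θ 1 (π ((g.symm.trans (β.trans g)) t * t⁻¹)) =
      (F.symm (toAdd (SurfaceGroup.abelianize 3 t))) ((0 : Fin 3), false) •
          ⁅-θ 0 (π (g (PresentedGroup.of ((1 : Fin 3), true)))), θ 0 (π (g (PresentedGroup.of ((0 : Fin 3), false))))⁆ +
        (F.symm (toAdd (SurfaceGroup.abelianize 3 t))) ((0 : Fin 3), true) •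
          ⁅-θ 0 (π (g (PresentedGroup.of ((1 : Fin 3), true)))), θ 0 (π (g (PresentedGroup.of ((0 : Fin 3), true))))⁆ +
        (-(F.symm (toAdd (SurfaceGroup.abelianize 3 t))) ((1 : Fin 3), false)) •
          ⁅θ 0 (π (g (PresentedGroup.of ((0 : Fin 3), false)))), θ 0 (π (g (PresentedGroup.of ((0 : Fin 3), true))))⁆ := by
  have hval := bpconj_class β g F hβIA hβa0 hβb0 hβa1 hβb1 hβa2 hβb2 hg t
  have hm : ∀ A B : SurfaceGroup 3, ⁅A, B⁆ ∈ (⊤ : Subgroup (SurfaceGroup 3)).lowerCentralSeries 1 := fun A B =>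
    commutator_mem_commutator (mem_top _) (mem_top _)
  rw [theta_pi_congr θ hadd hker π 1 (mul_mem (mul_mem (zpow_mem (hm _ _) _) (zpow_mem (hm _ _) _)) (zpow_mem (hm _ _) _)) hval,
    theta_pi_zpow_triple θ hadd π 1 (hm _ _) (hm _ _) (hm _ _)]
  have e : ∀ A B : SurfaceGroup 3, θ 1 (π ⁅A, B⁆) = ⁅θ 0 (π A), θ 0 (π B)⁆ := fun A B => by
    rw [map_commutatorElement]
    exact hbr 0 0 _ (mem_top _) _ (mem_top _)
  rw [e, e, e, map_inv, theta_inv θ hadd 0 (mem_top _)]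

end Symbols

end LayerZeroTwo

/-- **Registered helper `helper_layerZeroTwoBpGoeritz`** (sub-goal of stub `stub_layerStepZeroTwo`, item
stmt-SmoothPoincare4-14595): the bounding-pair map as a Goeritz element of `𝒥₁` with its letter values modulo `γ₃`,
in closed form (commutators spelled out). [folklore] -/
theorem helper_layerZeroTwoBpGoeritz : ∃ β : Literature.Topology.FourManifolds.SurfaceGroup 3 ≃* Literature.Topology.FourManifolds.SurfaceGroup 3, (Literature.Topology.FourManifolds.s4Kernels 0).map β.toMonoidHom = Literature.Topology.FourManifolds.s4Kernels 0 ∧ (Literature.Topology.FourManifolds.s4Kernels 1).map β.toMonoidHom = Literature.Topology.FourManifolds.s4Kernels 1 ∧ (∀ s : Literature.Topology.FourManifolds.SurfaceGroup 3, β s * s⁻¹ ∈ (⊤ : Subgroup (Literature.Topology.FourManifolds.SurfaceGroup 3)).lowerCentralSeries 1) ∧ ((β (PresentedGroup.of ((0 : Fin 3), false) : Literature.Topology.FourManifolds.SurfaceGroup 3) * ((PresentedGroup.of ((0 : Fin 3), false) : Literature.Topology.FourManifolds.SurfaceGroup 3))⁻¹ : Literature.Topology.FourManifolds.SurfaceGroup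 3) : Literature.Topology.FourManifolds.SurfaceGroup 3 ⧸ (⊤ : Subgroup (Literature.Topology.FourManifolds.SurfaceGroup 3)).lowerCentralSeries 2) = ((((PresentedGroup.of ((1 : Fin 3), true) : Literature.Topology.FourManifolds.SurfaceGroup 3) : Literature.Topology.FourManifolds.SurfaceGroup 3) : Literature.Topology.FourManifolds.SurfaceGroup 3 ⧸ (⊤ : Subgroup (Literature.Topology.FourManifolds.SurfaceGroup 3)).lowerCentralSeries 2))⁻¹ * (((PresentedGroup.of ((0 : Fin 3), false) : Literature.Topology.FourManifolds.SurfaceGroup 3) : Literature.Topology.FourManifolds.SurfaceGroup 3) : Literature.Topology.FourManifolds.SurfaceGroup 3 ⧸ (⊤ : Subgroup (Literature.Topology.FourManifolds.SurfaceGroup 3)).lowerCentralSeries 2) * (((((PresentedGroup.of ((1 : Fin 3), true) : Literature.Topology.FourManifolds.SurfaceGroup 3) : Literature.Topology.FourManifolds.SurfaceGroup 3) : Literature.Topology.FourManifolds.SurfaceGroup 3 ⧸ (⊤ : Subgroup (Literature.Topology.FourManifolds.SurfaceGroup 3)).lowerCentralSeries 2))⁻¹)⁻¹ * ((((PresentedGroup.of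 ((0 : Fin 3), false) : Literature.Topology.FourManifolds.SurfaceGroup 3) : Literature.Topology.FourManifolds.SurfaceGroup 3) : Literature.Topology.FourManifolds.SurfaceGroup 3 ⧸ (⊤ : Subgroup (Literature.Topology.FourManifolds.SurfaceGroup 3)).lowerCentralSeries 2))⁻¹ ∧ β (PresentedGroup.of ((2 : Fin 3), false) : Literature.Topology.FourManifolds.SurfaceGroup 3) = (PresentedGroup.of ((2 : Fin 3), false) : Literature.Topology.FourManifolds.SurfaceGroup 3) ∧ β (PresentedGroup.of ((2 : Fin 3), true) : Literature.Topology.FourManifolds.SurfaceGroup 3) = (PresentedGroup.of ((2 : Fin 3), true) : Literature.Topology.FourManifolds.SurfaceGroup 3) := by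
  obtain ⟨β, h0, h1, hIA, ha0, hb0, ha1, hb1, ha2, hb2⟩ := LayerZeroTwo.exists_bp_goeritz
  exact ⟨β, h0, h1, hIA, ha0, ha2, hb2⟩

end Summit.SmoothPoincare4.SmoothPoincare4.Theorems.ShadowApproximation.NilpotentGenusClass

end
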